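import Literature.RingTheory.HilbertSamuel.ProjDirectrixPlane
import HarnessLib

/-!
# Every `e(A) = t`: generators of `𝔪` adapted to the directrix — `t` of them whose symbols form a basis of `S_1/𝒯` —,
# the exceptional ideal at a point of `ℙ(Dir(A))` is generated by them, and every element of `𝔪` is a combination of them
# up to `(𝔪B)·𝔪_B` (CJS 2020, Def. 2.18 / Def. 6.34 (i), p. 103 L16)

Topic: `Literature/RingTheory/HilbertSamuel`. The general-`t` form of `ProjDirectrixPlane.lean` (`e(A) = 2`, an adapted
PAIR) and of the `e(A) = 1` lemmas of `ProjDirectrixLine.lean`: the linear algebra behind «`C_1 = ℙ(Dir_x(X)) ≅ ℙ^{t−1}_{k(x)}`»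
(CJS LNM 2270, p. 103 L16, Def. 6.34 (i)) and the input of the abstract chart file `ProjDirectrixSpaceChart.lean`. Let `A`
be a noetherian local ring with residue field `k`, `x_1, …, x_e` a minimal system of generators of `𝔪`, `J = J_x` the
tangent cone ideal, `𝒯 = 𝒯(J) ⊆ S_1` its directrix space (`e(A) = e − dim_k 𝒯`), and `c_1, …, c_r` any generators of `𝔪`
with expansions `c_l = Σ_i a_{li} x_i` and symbols `s_l = Σ_i ā_{li} X_i`. PROVED:

* (private) `exists_family_compl_of_finrank_add` — linear algebra: if `T ≤ S` are subspaces with `dim T + q = dim S < ∞` and the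
  `v_l ∈ S` span `S`, then some `q` of the `v_l` form a basis of `S` modulo `T` (every `m ∈ S` is `≡ Σ_i α_i v_{j_i}`, and
  `Σ_i α_i v_{j_i} ∈ T ⇒ α = 0`); by induction on `q` along the flag `T ⊂ T + k v_{j_0} ⊂ ⋯`;
* `exists_family_symbols_basis_mod_directrixSpace` — **`t = e(A)` generators adapted to the directrix**: indices
  `j : Fin t → Fin r` whose symbols `s_{j_0}, …, s_{j_{t−1}}` form a basis of `S_1/𝒯` (the symbols of ALL the `c_l` span
  `S_1`, `X_mem_span_symbol`); `basis_mod_directrixSpace_succAbove` re-centres such a family at any member `j_{i₀}`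
  (the shape `s_{j₀}; s_{j_1}, …, s_{j_q}`, `t = q + 1`, consumed by `ProjDirectrixSpaceChart.lean`);
* `exists_forall_map_sub_sum_mem_of_family` — **ratios**: for every `y ∈ 𝔪` there are `α_i ∈ A`, depending on `y` only,
  with `φ(y) − Σ_i φ(α_i)φ(c_{j_i}) ∈ (𝔪B)·𝔪_B` for every `φ : A → B` into a local ring with `φ(𝔪) ⊆ 𝔪_B` and
  `ProjDirLiftsInto φ x` («`ξ ∈ ℙ(Dir(A))`»);
* `map_maximalIdeal_eq_span_family_of_projDirLiftsInto` — **the exceptional ideal at a point of `ℙ(Dir)` is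
  `(φ c_{j_0}, …, φ c_{j_{t−1}})`** (Nakayama), so that `ℙ(Dir_x(X))` lies in the union of the `t` blow-up charts at the
  adapted generators.

Everything here is PROVED; no definitions and no named facts. NOT a statement of H. Hironaka's manuscript. AI-written
(res-type-031); weaker than expert review.

## References

* V. Cossart, U. Jannsen, S. Saito, *Desingularization: Invariants and Strategy*, LNM 2270 (2020), Lemma 2.7,
  Def. 2.18, Def. 2.26, Def. 6.34 (i), p. 103 L16. [CossartJannsenSaito2020]
-/

noncomputable section

open IsLocalRing MvPolynomial Module
open Literature.AlgebraicGeometry.Resolution Literature.RingTheory.MvPolynomial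

namespace Literature.RingTheory.HilbertSamuel

universe u v w

/-! ## Linear algebra: a subspace of codimension `q` and `q` vectors of a spanning family complementing it -/

section LinearAlgebra

variable {k : Type v} [Field k] {V : Type w} [AddCommGroup V] [Module k V]

/-- Adjoining a vector off a finite-dimensional subspace raises the dimension by exactly one. [folklore] -/
private theorem finrank_sup_span_singleton₅ {T : Submodule k V} [FiniteDimensional k T] {v : V} (hv : v ∉ T) :
    finrank k ↥(T ⊔ k ∙ v) = finrank k T + 1 := by
  have hv0 : v ≠ 0 := fun h => hv (h ▸ T.zero_mem)
  haveI : FiniteDimensional k ↥(k ∙ v) := FiniteDimensional.span_singleton k v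
  have hinf : T ⊓ (k ∙ v) = ⊥ := by
    refine (Submodule.eq_bot_iff _).mpr fun w hw => ?_
    obtain ⟨hwT, hwv⟩ := Submodule.mem_inf.mp hw
    obtain ⟨a, rfl⟩ := Submodule.mem_span_singleton.mp hwv
    by_cases ha : a = 0
    · rw [ha, zero_smul]
    · exact absurd (by simpa [smul_smul, inv_mul_cancel₀ ha] using T.smul_mem a⁻¹ hwT) hv
  have h := Submodule.finrank_sup_add_finrank_inf_eq T (k ∙ v)
  rw [hinf, finrank_bot, add_zero, finrank_span_singleton hv0] at h
  exact h

/-- **A spanning family of `S` contains a basis of `S` modulo a subspace `T ≤ S` of codimension `q`.** If `T ≤ S` with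
`dim T + q = dim S < ∞` and the `v_l ∈ S` span `S`, there are indices `j_0, …, j_{q−1}` such that every `m ∈ S` is
`≡ Σ_i α_i v_{j_i} (mod T)` and `Σ_i α_i v_{j_i} ∈ T` forces `α = 0`. Induction on `q`: pick `v_{j_0} ∉ T` and apply the
case `q − 1` to `T + k v_{j_0}`. [folklore] -/
private theorem exists_family_compl_of_finrank_add {S : Submodule k V} [FiniteDimensional k S] {ι : Type*} {v : ι → V}
    (hvS : ∀ l, v l ∈ S) (hspan : S ≤ Submodule.span k (Set.range v)) :
    ∀ (q : ℕ) {T : Submodule k V}, T ≤ S → finrank k T + q = finrank k S →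
      ∃ j : Fin q → ι, (∀ m ∈ S, ∃ α : Fin q → k, m - ∑ i, α i • v (j i) ∈ T) ∧
        (∀ α : Fin q → k, ∑ i, α i • v (j i) ∈ T → α = 0) := by
  intro q
  induction q with
  | zero =>
    intro T hTS hrank
    haveI : FiniteDimensional k T := Submodule.finiteDimensional_of_le hTS
    have hTS' : T = S := Submodule.eq_of_le_of_finrank_le hTS (by omega)
    refine ⟨Fin.elim0, fun m hm => ⟨Fin.elim0, ?_⟩, fun α _ => funext fun i => Fin.elim0 i⟩
    rw [Finset.univ_eq_empty, Finset.sum_empty, sub_zero, hTS']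
    exact hm
  | succ q ih =>
    intro T hTS hrank
    haveI : FiniteDimensional k T := Submodule.finiteDimensional_of_le hTS
    -- a first vector off `T`
    have h1 : ∃ j₀, v j₀ ∉ T := by
      by_contra hall
      simp only [not_exists, not_not] at hall
      have hST : S ≤ T := hspan.trans (Submodule.span_le.mpr (by rintro _ ⟨l, rfl⟩; exact hall l))
      have := Submodule.finrank_mono hST
      omega
    obtain ⟨j₀, hj₀⟩ := h1
    -- the next step of the flag
    have hT1S : T ⊔ k ∙ v j₀ ≤ S := sup_le hTS ((Submodule.span_singleton_le_iff_mem _ _).mpr (hvS j₀))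
    have hrank1 : finrank k ↥(T ⊔ k ∙ v j₀) + q = finrank k S := by
      rw [finrank_sup_span_singleton₅ hj₀]; omega
    obtain ⟨j, hjspan, hjindep⟩ := ih hT1S hrank1
    refine ⟨Matrix.vecCons j₀ j, fun m hm => ?_, fun α hα => ?_⟩
    · obtain ⟨α, hα⟩ := hjspan m hm
      obtain ⟨t, ht, w, hw, htw⟩ := Submodule.mem_sup.mp hα
      obtain ⟨β, rfl⟩ := Submodule.mem_span_singleton.mp hw
      refine ⟨Matrix.vecCons β α, ?_⟩
      rw [Fin.sum_univ_succ]
      simp only [Matrix.cons_val_zero, Matrix.cons_val_succ]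
      have : m - (β • v j₀ + ∑ i : Fin q, α i • v (j i)) = t := by
        have h' : t = (m - ∑ i : Fin q, α i • v (j i)) - β • v j₀ := by rw [← htw]; abel
        rw [h']; abel
      rw [this]
      exact ht
    · rw [Fin.sum_univ_succ] at hα
      simp only [Matrix.cons_val_zero, Matrix.cons_val_succ] at hα
      -- the tail lies in `T + k v_{j₀}`, hence vanishes
      have htail : ∑ i : Fin q, α i.succ • v (j i) ∈ T ⊔ k ∙ v j₀ := by
        have : ∑ i : Fin q, α i.succ • v (j i) =
            (α 0 • v j₀ + ∑ i : Fin q, α i.succ • v (j i)) - α 0 • v j₀ := by abel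
        rw [this]
        exact Submodule.sub_mem _ (Submodule.mem_sup_left hα)
          (Submodule.mem_sup_right (Submodule.smul_mem _ _ (Submodule.mem_span_singleton_self _)))
      have h0tail : (fun i : Fin q => α i.succ) = 0 := hjindep _ htail
      have htail0 : ∑ i : Fin q, α i.succ • v (j i) = 0 :=
        Finset.sum_eq_zero fun i _ => by rw [show α i.succ = 0 from congrFun h0tail i, zero_smul]
      rw [htail0, add_zero] at hα
      -- the head coefficient vanishes since `v_{j₀} ∉ T`
      have hα0 : α 0 = 0 := by
        by_contra hne
        exact hj₀ (by simpa [smul_smul, inv_mul_cancel₀ hne] using T.smul_mem (α 0)⁻¹ hα)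
      funext i
      refine Fin.cases ?_ (fun i' => ?_) i
      · exact hα0
      · exact congrFun h0tail i'

end LinearAlgebra

/-! ## Linear forms: coefficients -/

section LinearForms

variable {k : Type v} [Field k] {e : ℕ}

/-- The `X_i`-coefficient of `Σ v_j X_j` is `v_i`. [folklore] -/
private theorem coeff_single_one_linForm₆ (v : Fin e → k) (i : Fin e) :
    MvPolynomial.coeff (Finsupp.single i 1) (linForm v) = v i := by
  classical
  rw [linForm_apply, MvPolynomial.coeff_sum]
  simp_rw [MvPolynomial.coeff_smul, MvPolynomial.coeff_X, smul_eq_mul]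
  rw [Finset.sum_eq_single i]
  · simp
  · intro j _ hj
    rw [if_neg, mul_zero]
    exact fun h => hj (Finsupp.single_left_injective one_ne_zero h)
  · exact fun h => absurd (Finset.mem_univ i) h

end LinearForms

/-! ## `e(A) = t`: `t` generators adapted to the directrix -/

section Space

variable {A : Type u} [CommRing A] [IsLocalRing A] [IsNoetherianRing A] {e : ℕ} {x : Fin e → A}
  (hx : Ideal.span (Set.range x) = maximalIdeal A) (he : (maximalIdeal A).spanFinrank = e)
  {r : ℕ} {c : Fin r → A} (hc : Ideal.span (Set.range c) = maximalIdeal A)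
  (a : Fin r → Fin e → A) (hca : ∀ l, c l = ∑ i, a l i * x i)

include he hc hca in
/-- **`t = e(A)` generators adapted to the directrix.** Among any generators `c_1, …, c_r` of `𝔪` (with expansions
`c_l = Σ_i a_{li} x_i` in a minimal system `x`) there are `c_{j_0}, …, c_{j_{t−1}}`, `t = e(A)`, whose symbols form a basis of
`S_1` modulo the directrix space `𝒯`: every linear form is `L ≡ Σ_i α_i s_{j_i} (mod 𝒯)`, and `Σ_i α_i s_{j_i} ∈ 𝒯` forces
`α = 0` (the symbols of the `c_l` span `S_1`, `X_mem_span_symbol`; `dim 𝒯 + e(A) = dim S_1`). The `t = 2` case is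
`exists_pair_symbols_compl_directrixSpace`. [cite: CossartJannsenSaito2020, Lemma 2.7, Def. 2.18] -/
theorem exists_family_symbols_basis_mod_directrixSpace {t : ℕ} (hd : directrixDim (tangentConeIdeal x hx) = t) :
    ∃ j : Fin t → Fin r,
      (∀ L ∈ homogeneousSubmodule (Fin e) (ResidueField A) 1, ∃ α : Fin t → ResidueField A,
        L - ∑ i, α i • linForm (fun i' => residue A (a (j i) i')) ∈ directrixSpace (tangentConeIdeal x hx)) ∧
      (∀ α : Fin t → ResidueField A,
        ∑ i, α i • linForm (fun i' => residue A (a (j i) i')) ∈ directrixSpace (tangentConeIdeal x hx) → α = 0) := by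
  set T := directrixSpace (tangentConeIdeal x hx) with hT
  set S := homogeneousSubmodule (Fin e) (ResidueField A) 1 with hS
  haveI : FiniteDimensional (ResidueField A) S := by
    rw [hS, ← range_linForm]; infer_instance
  have hTS : T ≤ S := directrixSpace_le_one _
  have hrank : finrank (ResidueField A) T + t = finrank (ResidueField A) S := by
    rw [hS, finrank_homogeneousSubmodule_one, ← hd]
    exact finrank_directrixSpace_add_directrixDim _
  have hvS : ∀ l, linForm (fun i => residue A (a l i)) ∈ S := fun l => by
    rw [hS, ← range_linForm]; exact LinearMap.mem_range_self _ _
  have hspan : S ≤ Submodule.span (ResidueField A) (Set.range fun l => linForm fun i => residue A (a l i)) := by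
    rw [hS, homogeneousSubmodule_one_eq_span_X, Submodule.span_le]
    rintro _ ⟨i, rfl⟩
    exact X_mem_span_symbol hx he hc a hca i
  exact exists_family_compl_of_finrank_add hvS hspan t hTS hrank

variable {q : ℕ} {j : Fin (q + 1) → Fin r}
  (hjs : ∀ L ∈ homogeneousSubmodule (Fin e) (ResidueField A) 1, ∃ α : Fin (q + 1) → ResidueField A,
    L - ∑ i, α i • linForm (fun i' => residue A (a (j i) i')) ∈ directrixSpace (tangentConeIdeal x hx))
  (hji : ∀ α : Fin (q + 1) → ResidueField A,
    ∑ i, α i • linForm (fun i' => residue A (a (j i) i')) ∈ directrixSpace (tangentConeIdeal x hx) → α = 0)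

omit [IsNoetherianRing A] in
include hjs hji in
/-- **Re-centring an adapted family at one of its members** (`t = q + 1`): for every `i₀`, the symbols
`s_{j_{i₀}}; (s_{j_{i₀.succAbove m}})_m` satisfy the span / independence hypotheses of `ProjDirectrixSpaceChart.lean` (the chart
at `c_{j_{i₀}}` with the `q` affine coordinates `s_{j_m}/s_{j_{i₀}}`). [cite: CossartJannsenSaito2020, Def. 2.18, Def. 6.34 (i)] -/
theorem basis_mod_directrixSpace_succAbove (i₀ : Fin (q + 1)) :
    (∀ L ∈ homogeneousSubmodule (Fin e) (ResidueField A) 1, ∃ (α₀ : ResidueField A) (α : Fin q → ResidueField A),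
      L - α₀ • linForm (fun i' => residue A (a (j i₀) i')) -
          ∑ m, α m • linForm (fun i' => residue A (a (j (i₀.succAbove m)) i')) ∈
        directrixSpace (tangentConeIdeal x hx)) ∧
    (∀ (α₀ : ResidueField A) (α : Fin q → ResidueField A),
      α₀ • linForm (fun i' => residue A (a (j i₀) i')) +
          ∑ m, α m • linForm (fun i' => residue A (a (j (i₀.succAbove m)) i')) ∈
        directrixSpace (tangentConeIdeal x hx) → α₀ = 0 ∧ α = 0) := by
  constructor
  · intro L hL
    obtain ⟨α, hα⟩ := hjs L hL
    refine ⟨α i₀, fun m => α (i₀.succAbove m), ?_⟩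
    rw [Fin.sum_univ_succAbove _ i₀] at hα
    rwa [sub_sub]
  · intro α₀ α h
    set β : Fin (q + 1) → ResidueField A := Fin.insertNth i₀ α₀ α with hβ
    have hsum : ∑ i, β i • linForm (fun i' => residue A (a (j i) i')) =
        α₀ • linForm (fun i' => residue A (a (j i₀) i')) +
          ∑ m, α m • linForm (fun i' => residue A (a (j (i₀.succAbove m)) i')) := by
      rw [Fin.sum_univ_succAbove _ i₀, hβ, Fin.insertNth_apply_same]
      simp only [Fin.insertNth_apply_succAbove]
    have hβ0 : β = 0 := hji β (hsum ▸ h)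
    refine ⟨?_, funext fun m => ?_⟩
    · have := congrFun hβ0 i₀
      rwa [hβ, Fin.insertNth_apply_same] at this
    · have := congrFun hβ0 (i₀.succAbove m)
      rwa [hβ, Fin.insertNth_apply_succAbove] at this

/-! ## `e(A) = t`: ratios and the exceptional ideal at a point of `ℙ(Dir)` -/

variable {B : Type w} [CommRing B] [IsLocalRing B]

omit [IsNoetherianRing A] in
include hca hjs in
/-- **Ratios at a point of `ℙ(Dir(A))`.** For every `y ∈ 𝔪` there are `α_0, …, α_q ∈ A` — depending on `y` only — such
that for every `φ : A → B` into a local ring with `φ(𝔪) ⊆ 𝔪_B` and `ProjDirLiftsInto φ x`: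
`φ(y) − Σ_i φ(α_i)φ(c_{j_i}) ∈ (𝔪_A B)·𝔪_B`. Writing `y = Σ y_i x_i`, the form `ȳ − Σ ᾱ_i s_{j_i}` is chosen in `𝒯`, and
`y − Σ α_i c_{j_i}` is a lift of it. The `t = 2` case is `exists_forall_map_sub_sub_mem_of_pair`.
[cite: CossartJannsenSaito2020, Def. 6.34 (i)] -/
theorem exists_forall_map_sub_sum_mem_of_family {y : A} (hy : y ∈ maximalIdeal A) :
    ∃ α : Fin (q + 1) → A, ∀ (B : Type w) [CommRing B] [IsLocalRing B] (φ : A →+* B),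
      (maximalIdeal A).map φ ≤ maximalIdeal B → ProjDirLiftsInto φ x hx →
        φ y - ∑ i, φ (α i) * φ (c (j i)) ∈ (maximalIdeal A).map φ * maximalIdeal B := by
  classical
  -- `y = Σ y_i x_i`
  obtain ⟨yc, hyc⟩ : ∃ yc : Fin e → A, ∑ i, yc i * x i = y :=
    Ideal.mem_span_range_iff_exists_fun.mp (by rw [hx]; exact hy)
  have hL : linForm (fun i => residue A (yc i)) ∈ homogeneousSubmodule (Fin e) (ResidueField A) 1 := by
    rw [← range_linForm]; exact LinearMap.mem_range_self _ _
  obtain ⟨αb, hmem⟩ := hjs _ hL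
  have hlift : ∀ i, ∃ αi : A, residue A αi = αb i := fun i => Ideal.Quotient.mk_surjective (αb i)
  choose α hα using hlift
  refine ⟨α, fun B _ _ φ hφ hP => ?_⟩
  -- the lift `Σ_i' (y_{i'} − Σ_i α_i a_{j_i i'}) x_{i'} = y − Σ_i α_i c_{j_i}`
  let cf : Fin e → A := fun i' => yc i' - ∑ i, α i * a (j i) i'
  have hcf : ∀ i', residue A (cf i') = MvPolynomial.coeff (Finsupp.single i' 1)
      (linForm (fun i => residue A (yc i)) - ∑ i, αb i • linForm (fun i' => residue A (a (j i) i'))) := by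
    intro i'
    simp only [cf, MvPolynomial.coeff_sub, MvPolynomial.coeff_sum, MvPolynomial.coeff_smul, coeff_single_one_linForm₆,
      map_sub, map_sum, map_mul, smul_eq_mul, hα]
  have hval : ∑ i', cf i' * x i' = y - ∑ i, α i * c (j i) := by
    simp only [cf, sub_mul, Finset.sum_sub_distrib, hyc, Finset.sum_mul]
    congr 1
    rw [Finset.sum_comm]
    refine Finset.sum_congr rfl fun i _ => ?_
    rw [hca (j i), Finset.mul_sum]
    exact Finset.sum_congr rfl fun i' _ => by ring
  have h := hP _ hmem cf hcf
  rw [hval, map_sub, map_sum] at h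
  simpa only [map_mul] using h

omit [IsNoetherianRing A] in
include hca hjs in
/-- **`𝔪·B = (φ(c_{j_0}), …, φ(c_{j_q}))` at a point of `ℙ(Dir(A))`** (CJS p. 103: near `C_1 = ℙ(Dir_x) ≅ ℙ^{t−1}` the
exceptional divisor is cut out by `t` parameters): for `φ : A → B` into a local ring with `φ(𝔪) ⊆ 𝔪_B` and
`ProjDirLiftsInto φ x`, and `c_{j_0}, …, c_{j_q}` adapted to the directrix, `𝔪B = (φ c_{j_i})_i`. Proof:
`φ(x_i) ∈ (φ c_{j_i})_i + (𝔪B)𝔪_B` (`exists_forall_map_sub_sum_mem_of_family`), and Nakayama. The `t = 2` case is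
`map_maximalIdeal_eq_span_pair_of_projDirLiftsInto`. [cite: CossartJannsenSaito2020, Def. 6.34 (i)] -/
theorem map_maximalIdeal_eq_span_family_of_projDirLiftsInto
    (φ : A →+* B) (hφ : (maximalIdeal A).map φ ≤ maximalIdeal B) (hP : ProjDirLiftsInto φ x hx) :
    (maximalIdeal A).map φ = Ideal.span (Set.range fun i => φ (c (j i))) := by
  classical
  have hcm : ∀ l, c l ∈ maximalIdeal A := by
    intro l
    rw [hca l, ← hx]
    exact Ideal.sum_mem _ fun i _ => Ideal.mul_mem_left _ _ (Ideal.subset_span ⟨i, rfl⟩)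
  apply le_antisymm
  · -- Nakayama
    set N : Ideal B := (maximalIdeal A).map φ with hN
    have hNfg : N.FG := by
      rw [hN, ← hx, Ideal.map_span]
      exact ⟨(Finset.univ.image (φ ∘ x)), by
        rw [Finset.coe_image, Finset.coe_univ, Set.image_univ, Set.range_comp]⟩
    have hle : N ≤ Ideal.span (Set.range fun i => φ (c (j i))) ⊔ maximalIdeal B • N := by
      rw [hN, ← hx, Ideal.map_span, Ideal.span_le]
      rintro _ ⟨_, ⟨i, rfl⟩, rfl⟩
      obtain ⟨α, hα⟩ := exists_forall_map_sub_sum_mem_of_family hx a hca hjs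
        (show x i ∈ maximalIdeal A from hx ▸ Ideal.subset_span ⟨i, rfl⟩)
      have hmem := hα B φ hφ hP
      have : φ (x i) = (∑ i', φ (α i') * φ (c (j i'))) + (φ (x i) - ∑ i', φ (α i') * φ (c (j i'))) := by ring
      rw [this]
      refine Submodule.add_mem_sup ?_ ?_
      · exact Ideal.sum_mem _ fun i' _ => Ideal.mul_mem_left _ _ (Ideal.subset_span ⟨i', rfl⟩)
      · rw [Ideal.smul_eq_mul, mul_comm (maximalIdeal B), ← Ideal.map_span, hx]
        exact hmem
    exact Submodule.le_of_le_smul_of_le_jacobson_bot hNfg (IsLocalRing.maximalIdeal_le_jacobson ⊥) hle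
  · rw [Ideal.span_le]
    rintro _ ⟨i, rfl⟩
    exact Ideal.mem_map_of_mem φ (hcm (j i))

end Space

end Literature.RingTheory.HilbertSamuel

end
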